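import Summits.CriticalPhenomena.PercolationContinuityZ3.Theorems.Transplant.FKConnectivityAllQAntipodalRootFormBase

/-!
# Connectivity correlation inequalities for `φ_{w,q}`, every `q > 0` — ROOT-FORM CALCULUS, file 61t: the box `B ∥ g` inherits the single-box
# hypotheses of THEOREM G27 from `B`

Support file (`--supports stmt-CriticalPhenomena-4575`), FK sub-lane `prim-bschramm-fk-2` (gen 29); builds on p205010 (kernel theorem,
internal audit signed; external expert review pending).  No definitions, no named facts, no sorries; standard axioms.  Memo
FROM-fk-2-g28-ROOT-FORM.md §7; FK-Q2 §38.

`FK.RootForm.Base.thetaPair_parE_Mt_nonneg` (base fact 2 of the word theorem, `M̃_{g ∥ (B_y ∥ B_z)} ≥ 0`) asks the four single-box hypotheses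
(consistency, A1, A3n, A4n) of the abstract box `parBox Z = B_z ∥ g`.  This file derives them from those of `Z` by elementary bookkeeping:
closed forms of the generator integrands (`gA1_eq`, …), the data of `parBox` (`parBox_true/false`), and `parBox_consistent`, `parBox_A1`
(A1 of `B ∥ g` = A1 of `B` one level down against `h(t,·)+h(f,·)`), `parBox_A3n` (= A3n of `B` against the outer sections plus A1 of `B` against the
middle sections), `parBox_A4n` (≥ A4n of `B` against the lower sections; the rest is pointwise nonnegative).  Consequently fact 2 needs nothing
beyond the facts of the two boxes (`thetaPair_parE_Mt_nonneg'`).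
[folklore]
-/

noncomputable section

namespace Summit.CriticalPhenomena.PercolationContinuityZ3.Theorems

namespace FK

namespace RootForm

namespace Base

open Finset

section Closed

/-- congruence of differences of indicators. [folklore] -/
theorem ind_sub_congr {P P' Q Q' : Prop} [Decidable P] [Decidable P'] [Decidable Q] [Decidable Q'] (h1 : P ↔ P') (h2 : Q ↔ Q') :
    ind P - ind Q = ind P' - ind Q' := by rw [ind_congr h1, ind_congr h2]

/-- the integer indicator cast to `ℝ` is the real indicator (same instance). [folklore] -/
theorem cast_I (P : Prop) [Decidable P] : ((Cert.I P : ℤ) : ℝ) = ind P := by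
  unfold Cert.I ind; split_ifs <;> simp

/-- closed form of A1. [folklore] -/
theorem gA1_eq (d : BDat) (K : ℤ) :
    gA1 d K = ind (d.t0.L + bit d.t0.c + bit d.t0.cb ≤ K) - ind (d.t1.L + bit d.t1.c + bit d.t1.cb ≤ K) := by
  simp only [gA1, BDat.type, Cert.A1, Int.cast_sub, cast_I, bi_eq_bit]
  congr 1 <;> exact ind_congr (by omega)

/-- closed form of A3u. [folklore] -/
theorem gA3u_eq (d : BDat) (K : ℤ) : gA3u d K = ind (d.t0.L + bit d.t0.c ≤ K) - ind (d.t1.L + bit d.t1.c ≤ K) := by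
  simp only [gA3u, BDat.type, Cert.A3u, Int.cast_sub, cast_I, bi_eq_bit]
  congr 1 <;> exact ind_congr (by omega)

/-- closed form of A3l. [folklore] -/
theorem gA3l_eq (d : BDat) (K : ℤ) : gA3l d K = ind (d.t0.L + bit d.t0.cb ≤ K) - ind (d.t1.L + bit d.t1.cb ≤ K) := by
  simp only [gA3l, BDat.type, Cert.A3l, Int.cast_sub, cast_I, bi_eq_bit]
  congr 1 <;> exact ind_congr (by omega)

/-- closed form of A4u. [folklore] -/
theorem gA4u_eq (d : BDat) (K : ℤ) : gA4u d K = ind (d.t1.L = K) * (bit d.t1.c - bit d.t1.cb) := by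
  simp only [gA4u, BDat.type, Cert.A4u, Int.cast_mul, Int.cast_sub, cast_I, bi_eq_bit]
  congr 1; exact ind_congr (by omega)

/-- closed form of A4l. [folklore] -/
theorem gA4l_eq (d : BDat) (K : ℤ) : gA4l d K = ind (d.t0.L = K) * (bit d.t0.c - bit d.t0.cb) := by
  simp only [gA4l, BDat.type, Cert.A4l, Int.cast_mul, Int.cast_sub, cast_I, bi_eq_bit]
  congr 1; exact ind_congr (by omega)

variable {B' : Type*}

/-- data of `B ∥ g`, edge in replica 1. [folklore] -/
theorem parBox_true (Z : B' → BDat) (γ : B') :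
    parBox Z (true, γ) = ⟨⟨(Z γ).t0.L + bit (Z γ).t0.c, true, (Z γ).t0.cb⟩, ⟨(Z γ).t1.L + bit (Z γ).t1.c, true, (Z γ).t1.cb⟩⟩ := by
  simp [parBox, SDat.parS]

/-- data of `B ∥ g`, edge in replica 2. [folklore] -/
theorem parBox_false (Z : B' → BDat) (γ : B') :
    parBox Z (false, γ) = ⟨⟨(Z γ).t0.L + bit (Z γ).t0.cb, (Z γ).t0.c, true⟩, ⟨(Z γ).t1.L + bit (Z γ).t1.cb, (Z γ).t1.c, true⟩⟩ := by
  simp [parBox, SDat.parS]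

end Closed

section ParBox

variable {B' : Type*} [Fintype B'] [Preorder B'] (Z : B' → BDat)

omit [Fintype B'] [Preorder B'] in
/-- **Consistency of `B ∥ g`.** [folklore] -/
theorem parBox_consistent (hZ : ∀ γ, Cert.consistentB (Z γ).type = true) (q : Bool × B') :
    Cert.consistentB (parBox Z q).type = true := by
  obtain ⟨b, γ⟩ := q
  have h := hZ γ
  generalize hd : Z γ = d at h
  obtain ⟨⟨L0, c0, cb0⟩, ⟨L1, c1, cb1⟩⟩ := d
  cases b <;> cases c0 <;> cases cb0 <;> cases c1 <;> cases cb1 <;>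
    simp [parBox, SDat.parS, BDat.type, Cert.consistentB, hd, bit] at h ⊢ <;> omega

omit [Fintype B'] [Preorder B'] in
/-- A1 of `B ∥ g` is A1 of `B` one level down. [folklore] -/
theorem gA1_parBox (b : Bool) (γ : B') (K : ℤ) : gA1 (parBox Z (b, γ)) K = gA1 (Z γ) (K - 1) := by
  cases b
  · rw [parBox_false, gA1_eq, gA1_eq]
    exact ind_sub_congr (by simp only [bit_true]; omega) (by simp only [bit_true]; omega)
  · rw [parBox_true, gA1_eq, gA1_eq]
    exact ind_sub_congr (by simp only [bit_true]; omega) (by simp only [bit_true]; omega)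

omit [Fintype B'] [Preorder B'] in
/-- A3u/A3l of `B ∥ g`: outer sub-slots are A3u/A3l of `B` one level down, middle ones are A1 of `B`. [folklore] -/
theorem gA3_parBox (γ : B') (K : ℤ) :
    gA3u (parBox Z (true, γ)) K = gA3u (Z γ) (K - 1) ∧ gA3l (parBox Z (true, γ)) K = gA1 (Z γ) K ∧
      gA3u (parBox Z (false, γ)) K = gA1 (Z γ) K ∧ gA3l (parBox Z (false, γ)) K = gA3l (Z γ) (K - 1) := by
  rw [parBox_true, parBox_false, gA3u_eq, gA3u_eq, gA3l_eq, gA3l_eq, gA3u_eq, gA3l_eq, gA1_eq]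
  exact ⟨ind_sub_congr (by simp only [bit_true]; omega) (by simp only [bit_true]; omega),
    ind_sub_congr (by simp only) (by simp only), ind_sub_congr (by simp only; omega) (by simp only; omega),
    ind_sub_congr (by simp only [bit_true]; omega) (by simp only [bit_true]; omega)⟩

/-- **A1 for `B ∥ g`.** [folklore] -/
theorem parBox_A1 (hA1 : ∀ h : B' → ℝ, Monotone h → (∀ γ, 0 ≤ h γ) → ∀ K : ℤ, 0 ≤ ∑ γ, h γ * gA1 (Z γ) K)
    (h : Bool × B' → ℝ) (mh : Monotone h) (nh : ∀ q, 0 ≤ h q) (K : ℤ) : 0 ≤ ∑ q, h q * gA1 (parBox Z q) K := by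
  rw [Fintype.sum_prod_type, Fintype.sum_bool]
  simp only [gA1_parBox, ← Finset.sum_add_distrib, ← add_mul]
  exact hA1 _ ((mono_sec mh true).add (mono_sec mh false)) (fun γ => add_nonneg (nh _) (nh _)) (K - 1)

/-- **A3n for `B ∥ g`.** [folklore] -/
theorem parBox_A3n (hA1 : ∀ h : B' → ℝ, Monotone h → (∀ γ, 0 ≤ h γ) → ∀ K : ℤ, 0 ≤ ∑ γ, h γ * gA1 (Z γ) K)
    (hA3 : ∀ h0 h1 : B' → ℝ, Monotone h0 → Monotone h1 → (∀ γ, 0 ≤ h0 γ) → (∀ γ, h0 γ ≤ h1 γ) → ∀ K : ℤ,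
      0 ≤ ∑ γ, (h1 γ * gA3u (Z γ) K + h0 γ * gA3l (Z γ) K))
    (h0 h1 : Bool × B' → ℝ) (m0 : Monotone h0) (m1 : Monotone h1) (n0 : ∀ q, 0 ≤ h0 q) (le : ∀ q, h0 q ≤ h1 q) (K : ℤ) :
    0 ≤ ∑ q, (h1 q * gA3u (parBox Z q) K + h0 q * gA3l (parBox Z q) K) := by
  rw [Fintype.sum_prod_type, Fintype.sum_bool]
  have key1 := hA3 (fun γ => h0 (false, γ)) (fun γ => h1 (true, γ)) (mono_sec m0 false) (mono_sec m1 true) (fun γ => n0 _)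
    (fun γ => (sec_le m0 γ).trans (le _)) (K - 1)
  have key2 := hA1 (fun γ => h0 (true, γ) + h1 (false, γ)) ((mono_sec m0 true).add (mono_sec m1 false))
    (fun γ => add_nonneg (n0 _) ((n0 _).trans (le _))) K
  rw [← Finset.sum_add_distrib]
  have : ∑ γ, (h1 (true, γ) * gA3u (parBox Z (true, γ)) K + h0 (true, γ) * gA3l (parBox Z (true, γ)) K +
      (h1 (false, γ) * gA3u (parBox Z (false, γ)) K + h0 (false, γ) * gA3l (parBox Z (false, γ)) K)) =
      ∑ γ, (h1 (true, γ) * gA3u (Z γ) (K - 1) + h0 (false, γ) * gA3l (Z γ) (K - 1)) + ∑ γ, (h0 (true, γ) + h1 (false, γ)) * gA1 (Z γ) K := by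
    rw [← Finset.sum_add_distrib]; refine Finset.sum_congr rfl fun γ _ => ?_
    obtain ⟨e1, e2, e3, e4⟩ := gA3_parBox Z γ K
    rw [e1, e2, e3, e4]; ring
  rw [this]; exact add_nonneg key1 key2

omit [Fintype B'] [Preorder B'] in
/-- A4u of `B ∥ g` pointwise (state 1): with `u ≥ v ≥ 0` the weights of the two replicas of `g`, the `B ∥ g` terms dominate `v·A4u(B)` one
level down. [folklore] -/
theorem gA4u_parBox_ge (γ : B') (K : ℤ) {u v : ℝ} (h : v ≤ u) (hv : 0 ≤ v) :
    v * gA4u (Z γ) (K - 1) ≤ u * gA4u (parBox Z (true, γ)) K + v * gA4u (parBox Z (false, γ)) K := by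
  rw [parBox_true, parBox_false, gA4u_eq, gA4u_eq, gA4u_eq]; dsimp only
  obtain ⟨⟨L0, c0, cb0⟩, ⟨L1, c1, cb1⟩⟩ := Z γ
  dsimp only
  cases c1 <;> cases cb1 <;> simp only [bit_true, bit_false, add_zero, Int.cast_one, Int.cast_zero, ind] <;> split_ifs <;>
    first | nlinarith | (exfalso; omega)

omit [Fintype B'] [Preorder B'] in
/-- A4l of `B ∥ g` pointwise (state 0). [folklore] -/
theorem gA4l_parBox_ge (γ : B') (K : ℤ) {u v : ℝ} (h : v ≤ u) (hv : 0 ≤ v) :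
    v * gA4l (Z γ) (K - 1) ≤ u * gA4l (parBox Z (true, γ)) K + v * gA4l (parBox Z (false, γ)) K := by
  rw [parBox_true, parBox_false, gA4l_eq, gA4l_eq, gA4l_eq]; dsimp only
  obtain ⟨⟨L0, c0, cb0⟩, ⟨L1, c1, cb1⟩⟩ := Z γ
  dsimp only
  cases c0 <;> cases cb0 <;> simp only [bit_true, bit_false, add_zero, Int.cast_one, Int.cast_zero, ind] <;> split_ifs <;>
    first | nlinarith | (exfalso; omega)

/-- **A4n for `B ∥ g`.** [folklore] -/
theorem parBox_A4n (hA4 : ∀ h0 h1 : B' → ℝ, Monotone h0 → Monotone h1 → (∀ γ, 0 ≤ h0 γ) → (∀ γ, h0 γ ≤ h1 γ) → ∀ K : ℤ,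
      0 ≤ ∑ γ, (h1 γ * gA4u (Z γ) K + h0 γ * gA4l (Z γ) K))
    (h0 h1 : Bool × B' → ℝ) (m0 : Monotone h0) (m1 : Monotone h1) (n0 : ∀ q, 0 ≤ h0 q) (le : ∀ q, h0 q ≤ h1 q) (K : ℤ) :
    0 ≤ ∑ q, (h1 q * gA4u (parBox Z q) K + h0 q * gA4l (parBox Z q) K) := by
  rw [Fintype.sum_prod_type, Fintype.sum_bool, ← Finset.sum_add_distrib]
  have key := hA4 (fun γ => h0 (false, γ)) (fun γ => h1 (false, γ)) (mono_sec m0 false) (mono_sec m1 false) (fun γ => n0 _)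
    (fun γ => le _) (K - 1)
  refine key.trans (Finset.sum_le_sum fun γ _ => ?_)
  have h1 := gA4u_parBox_ge Z γ K (sec_le m1 γ) ((n0 _).trans (le _))
  have h0 := gA4l_parBox_ge Z γ K (sec_le m0 γ) (n0 _)
  linarith

/-- **Base fact 2 from the box facts alone.**  `M̃_{g ∥ (B_y ∥ B_z)} ≥ 0` for abstract boxes `Y, Z` satisfying consistency, A1, A3n, A4n.
[folklore] -/
theorem thetaPair_parE_Mt_nonneg' {B : Type*} [Fintype B] [Preorder B] (Y : B → BDat) (Z : B' → BDat)
    (hcY : ∀ β, Cert.consistentB (Y β).type = true) (hcZ : ∀ γ, Cert.consistentB (Z γ).type = true)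
    (hA1 : ∀ h : B → ℝ, Monotone h → (∀ β, 0 ≤ h β) → ∀ K : ℤ, 0 ≤ ∑ β, h β * gA1 (Y β) K)
    (hA3 : ∀ h0 h1 : B → ℝ, Monotone h0 → Monotone h1 → (∀ β, 0 ≤ h0 β) → (∀ β, h0 β ≤ h1 β) → ∀ K : ℤ,
      0 ≤ ∑ β, (h1 β * gA3u (Y β) K + h0 β * gA3l (Y β) K))
    (hA4 : ∀ h0 h1 : B → ℝ, Monotone h0 → Monotone h1 → (∀ β, 0 ≤ h0 β) → (∀ β, h0 β ≤ h1 β) → ∀ K : ℤ,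
      0 ≤ ∑ β, (h1 β * gA4u (Y β) K + h0 β * gA4l (Y β) K))
    (hB1 : ∀ h : B' → ℝ, Monotone h → (∀ γ, 0 ≤ h γ) → ∀ K : ℤ, 0 ≤ ∑ γ, h γ * gA1 (Z γ) K)
    (hB3 : ∀ h0 h1 : B' → ℝ, Monotone h0 → Monotone h1 → (∀ γ, 0 ≤ h0 γ) → (∀ γ, h0 γ ≤ h1 γ) → ∀ K : ℤ,
      0 ≤ ∑ γ, (h1 γ * gA3u (Z γ) K + h0 γ * gA3l (Z γ) K))
    (hB4 : ∀ h0 h1 : B' → ℝ, Monotone h0 → Monotone h1 → (∀ γ, 0 ≤ h0 γ) → (∀ γ, h0 γ ≤ h1 γ) → ∀ K : ℤ,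
      0 ≤ ∑ γ, (h1 γ * gA4u (Z γ) K + h0 γ * gA4l (Z γ) K))
    {H0 H1 : Bool × (B × B') → ℝ} (m0 : Monotone H0) (m1 : Monotone H1) (n0 : ∀ p, 0 ≤ H0 p) (le : ∀ p, H0 p ≤ H1 p) (J : ℤ) :
    0 ≤ Mt (parE (thetaPair Y Z)) H0 H1 J :=
  thetaPair_parE_Mt_nonneg Y Z hcY (parBox_consistent Z hcZ) hA1 hA3 hA4
    (fun h mh nh K => parBox_A1 Z hB1 h mh nh K) (fun h0 h1 m0' m1' n0' le' K => parBox_A3n Z hB1 hB3 h0 h1 m0' m1' n0' le' K)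
    (fun h0 h1 m0' m1' n0' le' K => parBox_A4n Z hB4 h0 h1 m0' m1' n0' le' K) m0 m1 n0 le J

end ParBox

end Base

end RootForm

end FK

end Summit.CriticalPhenomena.PercolationContinuityZ3.Theorems

end
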